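import Summits.QuantumAdvantage.QuantumAdvantage.Theses.CubicForrelation
import Literature.Computability.QuantumComplexity.ForrelationDirectSum
import Literature.Computability.QuantumComplexity.ForrelationDerivativeTables

/-!
# `NearExactIsExact` (stmt-QuantumAdvantage-14043), negative side — a cubic pair with `Φ = 15/16`

Negative-side (cdisprove) theorems for the crux
`Summit.QuantumAdvantage.QuantumAdvantage.Theses.CubicForrelation.NearExactIsExact`
("there is an absolute `θ < 1` with `Φ(f,g) > θ ⇒ Φ(f,g) = 1` for all cubic `f, g` on an even number of
bits"). The crux text conjectures the SHARP constant `θ = 7/8` (attained by the `T`-family at `n = 10`,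
a Maiorana–McFarland bent `g` whose dual has degree `4`). **That conjecture is false**: we give an explicit
cubic pair on `16` bits with `Φ = 15/16` (`forrelation_f16_g16`), so every admissible `θ` is `≥ 15/16`
(`not_nearExact_at_of_lt`, `not_nearExact_at_seven_eighths`, `nearExactIsExact_iff_ge`). The crux itself
(`∃ θ < 1`) is untouched.

**The witness** (refuter-cdisprove-stmt-QuantumAdvantage-14043-0, 2026-08-16; found by a search over
triangular *biquadratic* maps — quadratic with quadratic inverse — for one whose pull-back of a
codimension-4 flat is quadratic modulo quadratics; machine checks `jobs/biquad/verify.py`, `py/check16.py`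
in the seat folder, attached as item evidence). Let `π : 𝔽₂⁸ → 𝔽₂⁸` be the quadratic permutation
`π(y) = (y₀, y₁, y₂, y₃+y₀y₁, y₄+y₀y₂, y₅+y₁y₄+y₂y₃, y₆+y₀y₅+y₁y₄+y₃y₄,
 y₇+y₂+y₀y₂+y₀y₅+y₁y₂+y₁y₄+y₁y₅+y₁y₆+y₃y₅)` (`piV`). Its inverse `σ` (`sigV`) is quadratic in the
first seven coordinates (same formulas) and `σ₇(z) = z₇ + (z₀z₅+z₁z₄+z₁z₅+z₁z₆+z₃z₅) + 1_P(z)` with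
`P = {z₀ = 0, z₁ = 0, z₂ = 1, z₃ = 0}` a flat of codimension `4` — so `deg σ = 4` and the
Maiorana–McFarland bent function `g(y′,y″) = y′·π(y″)` on `16` bits (`g16`, cubic) has dual
`g̃(x′,x″) = x″·σ(x′)` of degree `5` (allowed by Hou's bound `deg g̃ ≤ (n+6)/4` exactly from `n = 14`).
With `τ := σ − e₇·1_P` (`tauV`, quadratic) and `f(x′,x″) = x″·τ(x′)` (`f16`, cubic),
`f ⊕ g̃ = x″₇·1_P(x′)` is the indicator of a codimension-5 flat, hence
`Φ(f,g) = 1 − 2·2⁻⁵ = 15/16`. In Lean: `W_{(-1)^g}(x′,x″) = 2⁸(−1)^{σ(x′)·x″}` (`W_g16`, character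
orthogonality + `π ∘ σ = σ ∘ π = id` by `decide`), `∑_x (−1)^{f(x)} W(x) = 2¹⁶·#{x′ : τ(x′) = σ(x′)}
= 2¹⁶·240` (`fsum_f16_g16`), `Φ = 2⁻²⁴·2¹⁶·240` (`forrelation_f16_g16`).

Mechanism note for provers (paper, seat NOTES/Disproof.lean): for `g` of Maiorana–McFarland SHAPE
(`y′·π(y″) ⊕ h(y″)`, `π` any quadratic map, equal split) and any cubic `f`, `Φ ∈ {1} ∪ [−1, 31/32]`, and
`Φ > 15/16` forces `π` biquadratic, `f = x″·π⁻¹(x′) ⊕ k(x′)` and `h ⊕ k∘π` a nonzero word of degree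
`≤ 6`; so `31/32` is the ceiling of this mechanism and any counterexample to the crux must be
non-Maiorana–McFarland on both sides.

Also here: closure of `IsDegLeFun` under `⊕ / ∧ / ¬` (`polyPhase_add`, `polyPhase_mul`,
`IsDegLeFun.bxor'`, `IsDegLeFun.band'`, `IsDegLeFun.bnot'`) used to certify cubicity structurally.
Everything is a theorem; axioms are the standard three (`decide` only on `Fin 8 → Bool`).
-/

noncomputable section

open Finset
open Literature.Computability.QuantumComplexity
open Literature.Computability.QuantumComplexity.Simon (sum_twist twist_xor_left)
open Literature.Computability.QuantumComplexity.DerivativeWalsh (W fsum fsum_eq_sum_mul_W phi_eq_fsum)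
open Literature.Computability.QuantumComplexity.BuzetChailloux (phi phi_signOf bxor zeroVec)

namespace Summit.QuantumAdvantage.QuantumAdvantage.Theorems.NearExactIsExact.Negative

/-! ### Algebraic degree is closed under `⊕`, `∧`, `¬` -/

section Deg

variable {n : ℕ}

/-- `[a + b = 1] = [a = 1] ⊕ [b = 1]` in `𝔽₂`. [folklore] -/
theorem zmod2_decide_add : ∀ a b : ZMod 2, decide (a + b = 1) = (decide (a = 1) ^^ decide (b = 1)) := by
  decide

/-- `[a · b = 1] = [a = 1] ∧ [b = 1]` in `𝔽₂`. [folklore] -/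
theorem zmod2_decide_mul : ∀ a b : ZMod 2, decide (a * b = 1) = (decide (a = 1) && decide (b = 1)) := by
  decide

/-- The Boolean function of a sum of polynomials is the xor. [folklore] -/
theorem polyPhase_add (p q : MvPolynomial (Fin n) (ZMod 2)) (x : Fin n → Bool) :
    polyPhase (p + q) x = (polyPhase p x ^^ polyPhase q x) := by
  rw [polyPhase_apply, polyPhase_apply, polyPhase_apply, map_add]
  exact zmod2_decide_add _ _

/-- The Boolean function of a product of polynomials is the conjunction. [folklore] -/
theorem polyPhase_mul (p q : MvPolynomial (Fin n) (ZMod 2)) (x : Fin n → Bool) :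
    polyPhase (p * q) x = (polyPhase p x && polyPhase q x) := by
  rw [polyPhase_apply, polyPhase_apply, polyPhase_apply, map_mul]
  exact zmod2_decide_mul _ _

/-- Degree `≤ d` is closed under xor. [cite: Carlet2020, §2.2.1 Def. 6] -/
theorem IsDegLeFun.bxor' {d : ℕ} {f g : (Fin n → Bool) → Bool} (hf : IsDegLeFun d f) (hg : IsDegLeFun d g) :
    IsDegLeFun d (fun x => f x ^^ g x) := by
  obtain ⟨p, hp, hpf⟩ := hf
  obtain ⟨q, hq, hqg⟩ := hg
  refine ⟨p + q, (MvPolynomial.totalDegree_add p q).trans (max_le hp hq), fun x => ?_⟩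
  rw [polyPhase_add, ← hpf, ← hqg]

/-- Degrees add under conjunction. [cite: Carlet2020, §2.2.1 Def. 6] -/
theorem IsDegLeFun.band' {a b d : ℕ} {f g : (Fin n → Bool) → Bool} (hf : IsDegLeFun a f) (hg : IsDegLeFun b g)
    (h : a + b ≤ d) : IsDegLeFun d (fun x => f x && g x) := by
  obtain ⟨p, hp, hpf⟩ := hf
  obtain ⟨q, hq, hqg⟩ := hg
  refine ⟨p * q, (MvPolynomial.totalDegree_mul p q).trans ((Nat.add_le_add hp hq).trans h), fun x => ?_⟩
  rw [polyPhase_mul, ← hpf, ← hqg]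

/-- Degree `≤ d` is closed under negation. [cite: Carlet2020, §2.2.1 Def. 6] -/
theorem IsDegLeFun.bnot' {d : ℕ} {f : (Fin n → Bool) → Bool} (hf : IsDegLeFun d f) :
    IsDegLeFun d (fun x => !f x) := by
  obtain ⟨p, hp, hpf⟩ := hf
  refine ⟨p + MvPolynomial.C 1, ?_, fun x => ?_⟩
  · exact (MvPolynomial.totalDegree_add _ _).trans (max_le hp ((MvPolynomial.totalDegree_C _).le.trans (Nat.zero_le _)))
  · show (!f x) = _
    rw [polyPhase_add, polyPhase_C, ← hpf]
    cases f x <;> rfl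

/-- Coordinates have degree `≤ 1`. [cite: Carlet2020, §2.2.1 Def. 6] -/
theorem isDegLeFun_coord (j : Fin n) : IsDegLeFun 1 (fun x : Fin n → Bool => x j) :=
  isDegLeFun_apply j le_rfl

/-- Coordinates have degree `≤ 2`. [cite: Carlet2020, §2.2.1 Def. 6] -/
theorem isDegLeFun_coord₂ (j : Fin n) : IsDegLeFun 2 (fun x : Fin n → Bool => x j) :=
  isDegLeFun_apply j (by norm_num)

end Deg

/-! ### The witness on `8 + 8` bits -/

/-- Bit vectors of length 8 (one half of the 16 input bits). -/
abbrev V := Fin 8 → Bool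

/-- The quadratic permutation `π` of `𝔽₂⁸` (triangular, found by the biquadratic-flat search). -/
def piV (y : V) : V :=
  ![y 0, y 1, y 2, y 3 ^^ (y 0 && y 1), y 4 ^^ (y 0 && y 2), y 5 ^^ (y 1 && y 4) ^^ (y 2 && y 3),
    y 6 ^^ (y 0 && y 5) ^^ (y 1 && y 4) ^^ (y 3 && y 4),
    y 7 ^^ y 2 ^^ (y 0 && y 2) ^^ (y 0 && y 5) ^^ (y 1 && y 2) ^^ (y 1 && y 4) ^^ (y 1 && y 5) ^^ (y 1 && y 6) ^^ (y 3 && y 5)]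

/-- The quadratic map `τ` (the inverse of `π` off the flat `P`). -/
def tauV (z : V) : V :=
  ![z 0, z 1, z 2, z 3 ^^ (z 0 && z 1), z 4 ^^ (z 0 && z 2), z 5 ^^ (z 1 && z 4) ^^ (z 2 && z 3),
    z 6 ^^ (z 0 && z 5) ^^ (z 1 && z 4) ^^ (z 3 && z 4),
    z 7 ^^ (z 0 && z 5) ^^ (z 1 && z 4) ^^ (z 1 && z 5) ^^ (z 1 && z 6) ^^ (z 3 && z 5)]

/-- Indicator of the codimension-4 flat `P = {z₀ = 0, z₁ = 0, z₂ = 1, z₃ = 0}`. -/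
def flatV (z : V) : Bool := !z 0 && !z 1 && z 2 && !z 3

/-- The inverse `σ = π⁻¹`: `τ` with the last coordinate corrected by `1_P` (so `deg σ₇ = 4`). -/
def sigV (z : V) : V := fun i => if i = 7 then tauV z 7 ^^ flatV z else tauV z i

/-- First half of a 16-bit vector. -/
def fst (x : Fin (8 + 8) → Bool) : V := fun i => x (Fin.castAdd 8 i)

/-- Second half of a 16-bit vector. -/
def snd (x : Fin (8 + 8) → Bool) : V := fun i => x (Fin.natAdd 8 i)

/-- `g(y', y'') = y' · π(y'')`: a Maiorana–McFarland cubic bent function on 16 bits whose dual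
`x'' · σ(x')` has degree 5. -/
def g16 (y : Fin (8 + 8) → Bool) : Bool :=
  (fst y 0 && piV (snd y) 0) ^^ (fst y 1 && piV (snd y) 1) ^^ (fst y 2 && piV (snd y) 2) ^^ (fst y 3 && piV (snd y) 3) ^^
  (fst y 4 && piV (snd y) 4) ^^ (fst y 5 && piV (snd y) 5) ^^ (fst y 6 && piV (snd y) 6) ^^ (fst y 7 && piV (snd y) 7)

/-- `f(x', x'') = x'' · τ(x')`: the cubic truncation of the dual of `g16` (they differ exactly on the
codimension-5 flat `{x''₇ = 1} × P`). -/
def f16 (x : Fin (8 + 8) → Bool) : Bool :=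
  (snd x 0 && tauV (fst x) 0) ^^ (snd x 1 && tauV (fst x) 1) ^^ (snd x 2 && tauV (fst x) 2) ^^ (snd x 3 && tauV (fst x) 3) ^^
  (snd x 4 && tauV (fst x) 4) ^^ (snd x 5 && tauV (fst x) 5) ^^ (snd x 6 && tauV (fst x) 6) ^^ (snd x 7 && tauV (fst x) 7)

/-- The first half of `a ++ b` is `a`. [folklore] -/
@[simp] theorem fst_append (a b : V) : fst (Fin.append a b) = a := by
  funext i; exact Fin.append_left a b i

/-- The second half of `a ++ b` is `b`. [folklore] -/
@[simp] theorem snd_append (a b : V) : snd (Fin.append a b) = b := by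
  funext i; exact Fin.append_right a b i

/-! ### Cubicity -/

/-- `g16` is cubic (structural degree bookkeeping: coordinates `1`, products `1+1 ≤ 2`, `1+2 ≤ 3`).
[folklore] -/
theorem isDegLeFun_g16 : IsDegLeFun 3 g16 := by
  unfold g16 fst snd piV
  simp only [Matrix.cons_val_zero, Matrix.cons_val_one, Matrix.cons_val]
  repeat (first
      | exact isDegLeFun_coord _
      | exact isDegLeFun_coord₂ _
      | exact isDegLeFun_const _ _
      | apply IsDegLeFun.bxor'
      | apply IsDegLeFun.band' (a := 1) (b := 1) (d := 2) _ _ (by norm_num)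
      | apply IsDegLeFun.band' (a := 1) (b := 2) (d := 3) _ _ (by norm_num)
      | apply IsDegLeFun.bnot')

/-- `f16` is cubic. [folklore] -/
theorem isDegLeFun_f16 : IsDegLeFun 3 f16 := by
  unfold f16 fst snd tauV
  simp only [Matrix.cons_val_zero, Matrix.cons_val_one, Matrix.cons_val]
  repeat (first
      | exact isDegLeFun_coord _
      | exact isDegLeFun_coord₂ _
      | exact isDegLeFun_const _ _
      | apply IsDegLeFun.bxor'
      | apply IsDegLeFun.band' (a := 1) (b := 1) (d := 2) _ _ (by norm_num)
      | apply IsDegLeFun.band' (a := 1) (b := 2) (d := 3) _ _ (by norm_num)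
      | apply IsDegLeFun.bnot')

/-! ### `π` is a permutation with inverse `σ`; `σ` and `τ` agree off the flat -/

set_option maxRecDepth 100000 in
/-- `σ ∘ π = id` (256 cases, by `decide`). [folklore] -/
theorem sig_pi : ∀ y : V, sigV (piV y) = y := by decide

set_option maxRecDepth 100000 in
/-- `π ∘ σ = id` (256 cases, by `decide`). [folklore] -/
theorem pi_sig : ∀ z : V, piV (sigV z) = z := by decide

/-- `π(y) = x ↔ y = σ(x)`. [folklore] -/
theorem piV_eq_iff (y x : V) : piV y = x ↔ y = sigV x := by
  constructor
  · rintro rfl; exact (sig_pi y).symm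
  · rintro rfl; exact pi_sig x

/-- `τ(z) = σ(z)` exactly off the flat `P`. [folklore] -/
theorem tauV_eq_sigV_iff (z : V) : tauV z = sigV z ↔ flatV z = false := by
  constructor
  · intro h
    have h7 := congrFun h 7
    simp only [sigV, if_true] at h7
    revert h7
    cases tauV z 7 <;> cases flatV z <;> simp
  · intro h
    funext i
    by_cases hi : i = 7
    · subst hi; simp [sigV, h]
    · simp [sigV, hi]

/-! ### Characters -/

/-- `(-1)^{[dot]}`: the sign of an 8-term inner product is the twist. [folklore] -/
theorem signOf_dot8 (u v : V) :
    signOf ((u 0 && v 0) ^^ (u 1 && v 1) ^^ (u 2 && v 2) ^^ (u 3 && v 3) ^^ (u 4 && v 4) ^^ (u 5 && v 5) ^^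
      (u 6 && v 6) ^^ (u 7 && v 7)) = twist u v := by
  simp only [signOf_xor, twist, Fin.prod_univ_eight]
  rfl

/-- `(-1)^{g(y',y'')} = (-1)^{y'·π(y'')}`. [folklore] -/
theorem signOf_g16 (y₁ y₂ : V) : signOf (g16 (Fin.append y₁ y₂)) = twist y₁ (piV y₂) := by
  rw [g16, fst_append, snd_append]
  exact signOf_dot8 y₁ (piV y₂)

/-- `(-1)^{f(x',x'')} = (-1)^{τ(x')·x''}`. [folklore] -/
theorem signOf_f16 (x₁ x₂ : V) : signOf (f16 (Fin.append x₁ x₂)) = twist (tauV x₁) x₂ := by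
  rw [f16, fst_append, snd_append, twist_comm]
  exact signOf_dot8 x₂ (tauV x₁)

/-- `(-1)^{u·s} (-1)^{u·t} = (-1)^{(s ⊕ t)·u}`. [folklore] -/
theorem twist_mul_twist_right (u s t : V) : twist u s * twist u t = twist (bxor s t) u := by
  rw [twist_comm u s, twist_comm u t]
  exact (twist_xor_left s t u).symm

/-- `s ⊕ t = 0 ↔ s = t`. [folklore] -/
theorem bxor_eq_zero_iff (s t : V) : (bxor s t = fun _ => false) ↔ s = t := by
  constructor
  · intro h; funext i
    have hi := congrFun h i
    revert hi
    simp only [bxor]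
    cases s i <;> cases t i <;> simp
  · rintro rfl; funext i; simp [bxor]

/-! ### The Walsh transform of `g16` and the forrelation sum -/

/-- **McFarland's dual formula** for this `g`: `W_{(-1)^g}(x', x'') = 2⁸ · (-1)^{σ(x')·x''}`. [folklore] -/
theorem W_g16 (x₁ x₂ : V) :
    W (fun y => signOf (g16 y)) (Fin.append x₁ x₂) = (2 : ℝ) ^ 8 * twist (sigV x₁) x₂ := by
  rw [W, sum_append]
  simp_rw [signOf_g16, twist_append]
  have inner : ∀ y₂ : V, ∑ y₁ : V, twist y₁ (piV y₂) * (twist y₁ x₁ * twist y₂ x₂) =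
      twist y₂ x₂ * (if y₂ = sigV x₁ then (2 : ℝ) ^ 8 else 0) := by
    intro y₂
    have e : ∀ y₁ : V, twist y₁ (piV y₂) * (twist y₁ x₁ * twist y₂ x₂) =
        twist y₂ x₂ * twist (bxor (piV y₂) x₁) y₁ := by
      intro y₁; rw [← twist_mul_twist_right]; ring
    rw [Finset.sum_congr rfl fun y₁ _ => e y₁, ← mul_sum, sum_twist]
    congr 1
    refine if_congr ?_ rfl rfl
    rw [bxor_eq_zero_iff, piV_eq_iff]
  rw [sum_comm, Finset.sum_congr rfl fun y₂ _ => inner y₂]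
  simp_rw [mul_ite, mul_zero]
  rw [Finset.sum_ite_eq' univ (sigV x₁), if_pos (mem_univ _)]
  ring

/-- The flat `P × 𝔽₂⁴` has `16` of the `256` points; its complement has `240`. [folklore] -/
theorem sum_nonflat : ∑ z : V, (if flatV z = false then (1 : ℝ) else 0) = 240 := by
  have h1 : ∑ z : V, (if flatV z = false then (1 : ℝ) else 0) = ∑ z : V, (1 - (if flatV z = true then (1 : ℝ) else 0)) := by
    refine sum_congr rfl fun z _ => ?_
    cases flatV z <;> simp
  have h2 : ∑ z : V, (if flatV z = true then (1 : ℝ) else 0) = 16 := by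
    have e : ∀ z : Fin (4 + 4) → Bool, (if flatV z = true then (1 : ℝ) else 0) =
        (if (fun i : Fin 4 => z (Fin.castAdd 4 i)) = ![false, false, true, false] then (1 : ℝ) else 0) := by
      intro z
      refine if_congr ?_ rfl rfl
      rw [funext_iff, Fin.forall_fin_succ, Fin.forall_fin_succ, Fin.forall_fin_succ, Fin.forall_fin_one]
      simp only [flatV, Matrix.cons_val_zero, Matrix.cons_val_succ, Matrix.cons_val_fin_one,
        Bool.and_eq_true, Bool.not_eq_true']
      constructor
      · rintro ⟨⟨⟨h0, h1⟩, h2⟩, h3⟩; exact ⟨h0, h1, h2, h3⟩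
      · rintro ⟨h0, h1, h2, h3⟩; exact ⟨⟨⟨h0, h1⟩, h2⟩, h3⟩
    rw [show (∑ z : V, if flatV z = true then (1 : ℝ) else 0) =
        ∑ z : Fin (4 + 4) → Bool, if flatV z = true then (1 : ℝ) else 0 from rfl]
    rw [Finset.sum_congr rfl fun z _ => e z, sum_append]
    simp only [Fin.append_left]
    have e2 : ∀ a : Fin 4 → Bool, (∑ _b : Fin 4 → Bool, if (fun i => a i) = ![false, false, true, false] then (1 : ℝ) else 0)
        = if a = ![false, false, true, false] then (16 : ℝ) else 0 := by
      intro a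
      rw [sum_const, card_univ, Fintype.card_fun, Fintype.card_bool, Fintype.card_fin, nsmul_eq_mul]
      split_ifs <;> norm_num
    rw [Finset.sum_congr rfl fun a _ => e2 a, Finset.sum_ite_eq' univ, if_pos (mem_univ _)]
  rw [h1, sum_sub_distrib, h2, sum_const, card_univ, Fintype.card_fun, Fintype.card_bool, Fintype.card_fin]
  norm_num

/-- `∑_x (-1)^{f(x)} W_{(-1)^g}(x) = 2¹⁶ · 240`. [folklore] -/
theorem fsum_f16_g16 : ∑ x, signOf (f16 x) * W (fun y => signOf (g16 y)) x = (2 : ℝ) ^ 16 * 240 := by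
  rw [sum_append]
  simp_rw [signOf_f16, W_g16]
  have inner : ∀ x₁ : V, ∑ x₂ : V, twist (tauV x₁) x₂ * ((2 : ℝ) ^ 8 * twist (sigV x₁) x₂) =
      (2 : ℝ) ^ 8 * (if flatV x₁ = false then (2 : ℝ) ^ 8 else 0) := by
    intro x₁
    have e : ∀ x₂ : V, twist (tauV x₁) x₂ * ((2 : ℝ) ^ 8 * twist (sigV x₁) x₂) =
        (2 : ℝ) ^ 8 * twist (bxor (tauV x₁) (sigV x₁)) x₂ := by
      intro x₂; rw [twist_xor_left]; ring
    rw [Finset.sum_congr rfl fun x₂ _ => e x₂, ← mul_sum, sum_twist]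
    congr 1
    refine if_congr ?_ rfl rfl
    rw [bxor_eq_zero_iff, tauV_eq_sigV_iff]
  rw [Finset.sum_congr rfl fun x₁ _ => inner x₁, ← mul_sum]
  simp_rw [show ∀ x₁ : V, (if flatV x₁ = false then (2 : ℝ) ^ 8 else 0) = (2 : ℝ) ^ 8 * (if flatV x₁ = false then (1 : ℝ) else 0)
    from fun x₁ => by split_ifs <;> ring]
  rw [← mul_sum, sum_nonflat]
  ring

/-- `√(2⁴⁸) = 2²⁴`. [folklore] -/
theorem sqrt_two_pow_48 : Real.sqrt ((2 : ℝ) ^ (3 * (8 + 8))) = 2 ^ 24 := by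
  rw [show (2 : ℝ) ^ (3 * (8 + 8)) = (2 ^ 24) ^ 2 by norm_num, Real.sqrt_sq (by positivity)]

/-- **The witness**: `Φ(f16, g16) = 2^{-24} · 2¹⁶ · 240 = 15/16`. [folklore] -/
theorem forrelation_f16_g16 : forrelation f16 g16 = 15 / 16 := by
  rw [← phi_signOf, phi_eq_fsum, fsum_eq_sum_mul_W, sqrt_two_pow_48, fsum_f16_g16]
  norm_num

/-! ### Consequences for the crux -/

open Summit.QuantumAdvantage.QuantumAdvantage.Theses.CubicForrelation (NearExactIsExact)

/-- The crux is, definitionally, `∃ θ < 1` such that cubic pairs with `Φ > θ` are exact; we use the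
fixed-threshold clause `∀ n, Even n → ∀ f g, cubic → cubic → θ < Φ → Φ = 1` inline below. [folklore] -/
theorem nearExactIsExact_iff : NearExactIsExact ↔ ∃ θ : ℝ, θ < 1 ∧
    ∀ n : ℕ, Even n → ∀ f g : (Fin n → Bool) → Bool, IsDegLeFun 3 f → IsDegLeFun 3 g →
      θ < forrelation f g → forrelation f g = 1 := Iff.rfl

/-- **A cubic pair with `Φ = 15/16`** on `16` bits. [folklore] -/
theorem exists_cubic_pair_forrelation_eq :
    ∃ f g : (Fin (8 + 8) → Bool) → Bool, IsDegLeFun 3 f ∧ IsDegLeFun 3 g ∧ forrelation f g = 15 / 16 :=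
  ⟨f16, g16, isDegLeFun_f16, isDegLeFun_g16, forrelation_f16_g16⟩

/-- **No threshold below `15/16` isolates exactness** — in particular the conjectured sharp constant
`θ = 7/8` of the crux text is refuted: every `θ` witnessing `NearExactIsExact` is `≥ 15/16`.
[folklore] -/
theorem not_nearExact_at_of_lt {θ : ℝ} (hθ : θ < 15 / 16) :
    ¬ (∀ n : ℕ, Even n → ∀ f g : (Fin n → Bool) → Bool, IsDegLeFun 3 f → IsDegLeFun 3 g →
        θ < forrelation f g → forrelation f g = 1) := by
  intro h
  have h1 := h (8 + 8) ⟨8, rfl⟩ f16 g16 isDegLeFun_f16 isDegLeFun_g16 (by rw [forrelation_f16_g16]; exact hθ)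
  rw [forrelation_f16_g16] at h1
  norm_num at h1

/-- The conjectured sharp form of the crux (`θ = 7/8`: "`Φ > 7/8 ⇒ Φ = 1` for cubic pairs on an even
number of bits") is FALSE. [folklore] -/
theorem not_nearExact_at_seven_eighths :
    ¬ (∀ n : ℕ, Even n → ∀ f g : (Fin n → Bool) → Bool, IsDegLeFun 3 f → IsDegLeFun 3 g →
        (7 : ℝ) / 8 < forrelation f g → forrelation f g = 1) :=
  not_nearExact_at_of_lt (by norm_num)

/-- Reformulation for provers: the crux holds iff it holds with some threshold `θ ∈ [15/16, 1)`.
[folklore] -/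
theorem nearExactIsExact_iff_ge :
    NearExactIsExact ↔ ∃ θ : ℝ, 15 / 16 ≤ θ ∧ θ < 1 ∧
      ∀ n : ℕ, Even n → ∀ f g : (Fin n → Bool) → Bool, IsDegLeFun 3 f → IsDegLeFun 3 g →
        θ < forrelation f g → forrelation f g = 1 := by
  rw [nearExactIsExact_iff]
  constructor
  · rintro ⟨θ, hθ1, h⟩
    refine ⟨max θ (15 / 16), le_max_right _ _, max_lt hθ1 (by norm_num), ?_⟩
    exact fun n hn f g hf hg hlt => h n hn f g hf hg (lt_of_le_of_lt (le_max_left _ _) hlt)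
  · rintro ⟨θ, -, hθ1, h⟩
    exact ⟨θ, hθ1, h⟩

end Summit.QuantumAdvantage.QuantumAdvantage.Theorems.NearExactIsExact.Negative
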